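import Summits.NavierStokesRegularity.NavierStokesRegularity.Theorems.SqueezeCycleRecurrentLiouvilleClassLimit
import Summits.NavierStokesRegularity.NavierStokesRegularity.Theorems.SqueezeCycleRecurrentLiouvilleOrbitContinuous
import Summits.NavierStokesRegularity.NavierStokesRegularity.Theorems.SqueezeCycleRecurrentLiouvilleAxisymRegular
import Literature.Analysis.FluidPDE.Seregin2020AncientLimitSymmetry
import HarnessLib

/-!
# Crux `RecurrentLiouville` (stmt-NavierStokesRegularity-1589), line `Sketch` — Branch C, fast branch:
  rotational absorption in the Albritton–Barker class

`rotationalAbsorptionFast` (alias `stub_rlRotationalAbsorptionFast`): ∀ `C`, `M < ⊤` ∃ `ᾱ`, `δ > 0`: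
a class profile (suitable weak on `ℝ³ × ℝ₋`, weak gradient, `𝐈 ≤ M`, rate `C`) whose scaling orbit is
`δ`-shadowed in `L³(Q(0,2))` by a rotation about the `x₃`-axis of angular log-speed `|α| ≥ ᾱ` is
regular at the origin — the fast half of the rotated-self-similar rung (cf. Pineau–Vicol 2026 Thm 1.4),
open and decay-free in the crux's class: such orbits are absorbed into the axisymmetric rung
(`stub_rlAxisymRegular`, Seregin–Šverák 2009 Thm 3.1) via orbit continuity (`stub_rlOrbitContinuous`)
and compactness (`stub_rlClassLimit`); the space–time rotation bookkeeping is the tree's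
`Seregin2020.measurePreserving_rotST_restrict`.  Refs: [SereginSverak2009] Thm 3.1; [PineauVicol2026] Thm 1.4.
-/


noncomputable section

-- the sub-problem namespace repeats the summit name (D-0017 layout `Summit.<S>.<P>.Theorems`)
set_option linter.dupNamespace false

namespace Summit.NavierStokesRegularity.NavierStokesRegularity.Theorems

open MeasureTheory Set Function Filter Topology TopologicalSpace Metric Literature.Analysis.FluidPDE
open scoped NNReal ENNReal

/-- **`L³(Q(0,R))` is invariant under the rotated conjugation** `v ↦ R_θ ∘ v ∘ T_{-θ}`:
`‖R_θ (f ∘ T_{-θ}) − R_θ (g ∘ T_{-θ})‖ = ‖f − g‖`. [folklore] -/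
theorem rlRotAbs_eLpNorm_conj (θ R : ℝ) {f g : ℝ × EuclideanSpace ℝ (Fin 3) → EuclideanSpace ℝ (Fin 3)}
    (hf : AEStronglyMeasurable f (volume.restrict (parabolicCylinder R (0 : ℝ × EuclideanSpace ℝ (Fin 3)))))
    (hg : AEStronglyMeasurable g (volume.restrict (parabolicCylinder R (0 : ℝ × EuclideanSpace ℝ (Fin 3))))) :
    eLpNorm (fun z : ℝ × EuclideanSpace ℝ (Fin 3) =>
        rotZ θ (f (z.1, rotZ (-θ) z.2)) - rotZ θ (g (z.1, rotZ (-θ) z.2))) 3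
        (volume.restrict (parabolicCylinder R (0 : ℝ × EuclideanSpace ℝ (Fin 3)))) =
      eLpNorm (f - g) 3 (volume.restrict (parabolicCylinder R (0 : ℝ × EuclideanSpace ℝ (Fin 3)))) := by
  -- the outer rotation is an isometry
  have h1 : eLpNorm (fun z : ℝ × EuclideanSpace ℝ (Fin 3) =>
        rotZ θ (f (z.1, rotZ (-θ) z.2)) - rotZ θ (g (z.1, rotZ (-θ) z.2))) 3
        (volume.restrict (parabolicCylinder R (0 : ℝ × EuclideanSpace ℝ (Fin 3)))) =
      eLpNorm ((f - g) ∘ fun z : ℝ × EuclideanSpace ℝ (Fin 3) => (z.1, rotZ (-θ) z.2)) 3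
        (volume.restrict (parabolicCylinder R (0 : ℝ × EuclideanSpace ℝ (Fin 3)))) := by
    refine eLpNorm_congr_norm_ae (Eventually.of_forall fun z => ?_)
    simp only [Function.comp_apply, Pi.sub_apply]
    change ‖rotZLIE θ (f (z.1, rotZ (-θ) z.2)) - rotZLIE θ (g (z.1, rotZ (-θ) z.2))‖ = _
    rw [← map_sub, LinearIsometryEquiv.norm_map]
  rw [h1]
  exact eLpNorm_comp_measurePreserving (hf.sub hg) (Seregin2020.measurePreserving_rotST_restrict (-θ) R)


/-- Rotated conjugates of measurable fields are measurable on the balls. [folklore] -/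
theorem rlRotAbs_aesm_conj (θ R : ℝ) {g : ℝ × EuclideanSpace ℝ (Fin 3) → EuclideanSpace ℝ (Fin 3)}
    (hg : AEStronglyMeasurable g (volume.restrict (parabolicCylinder R (0 : ℝ × EuclideanSpace ℝ (Fin 3))))) :
    AEStronglyMeasurable (fun z : ℝ × EuclideanSpace ℝ (Fin 3) => rotZ θ (g (z.1, rotZ (-θ) z.2)))
      (volume.restrict (parabolicCylinder R (0 : ℝ × EuclideanSpace ℝ (Fin 3)))) :=
  (rotZLIE θ).continuous.comp_aestronglyMeasurable
    (hg.comp_measurePreserving (Seregin2020.measurePreserving_rotST_restrict (-θ) R))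

/-- The exact scaling constant `c (c⁵)^{-1/3}` is bounded on `[e^{-a}, e^{a}]`. [folklore] -/
theorem rlRotAbs_zoomConst_le {a c : ℝ} (hc1 : Real.exp (-a) ≤ c) (hc2 : c ≤ Real.exp a) :
    ‖c‖ₑ * (ENNReal.ofReal (c ^ 2 * c ^ 3)⁻¹) ^ (1 / (3 : ℝ≥0∞).toReal) ≤
      ENNReal.ofReal (Real.exp a) *
        (ENNReal.ofReal (Real.exp (-a) ^ 2 * Real.exp (-a) ^ 3)⁻¹) ^ (1 / (3 : ℝ≥0∞).toReal) := by
  have hc0 : 0 < c := (Real.exp_pos _).trans_le hc1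
  have h0 : 0 ≤ Real.exp (-a) := (Real.exp_pos _).le
  have hle : Real.exp (-a) ^ 2 * Real.exp (-a) ^ 3 ≤ c ^ 2 * c ^ 3 :=
    mul_le_mul (pow_le_pow_left₀ h0 hc1 2) (pow_le_pow_left₀ h0 hc1 3) (by positivity) (by positivity)
  refine mul_le_mul' ?_ (ENNReal.rpow_le_rpow (ENNReal.ofReal_le_ofReal (inv_anti₀ (by positivity) hle))
    (by norm_num))
  rw [Real.enorm_eq_ofReal hc0.le]
  exact ENNReal.ofReal_le_ofReal hc2

/-- **The fixed-angle estimate.**  If `u_j → w` in `L³(Q(0,R))` for all `R`, the scaling orbit of `w`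
is continuous in `L³(Q(0,2))`, `c_j → 1` with `e^{-a} ≤ c_j ≤ e^{a}`, and the rotated rescalings
`R_θ (u_j)_{c_j} ∘ T_{-θ}` are `δ_j`-close to `u_j` on `Q(0,2)` with `δ_j → 0`, then
`R_θ (w ∘ T_{-θ}) = w` a.e. on `Q(0,2)`. [folklore] -/
theorem rlRotAbs_fixedAngle (θ a : ℝ)
    {uj : ℕ → ℝ → EuclideanSpace ℝ (Fin 3) → EuclideanSpace ℝ (Fin 3)}
    {w : ℝ → EuclideanSpace ℝ (Fin 3) → EuclideanSpace ℝ (Fin 3)} {c : ℕ → ℝ} {δ' : ℕ → ℝ≥0∞}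
    (hum : ∀ (j : ℕ) (r : ℝ), 0 < r → ∀ R : ℝ, 0 < R → AEStronglyMeasurable (uncurry (nsRescale r (uj j)))
      (volume.restrict (parabolicCylinder R (0 : ℝ × EuclideanSpace ℝ (Fin 3)))))
    (hwm : ∀ (r : ℝ), 0 < r → ∀ R : ℝ, 0 < R → AEStronglyMeasurable (uncurry (nsRescale r w))
      (volume.restrict (parabolicCylinder R (0 : ℝ × EuclideanSpace ℝ (Fin 3)))))
    (hc0 : ∀ j, 0 < c j) (hclo : ∀ j, Real.exp (-a) ≤ c j) (hchi : ∀ j, c j ≤ Real.exp a)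
    (hc1 : Tendsto c atTop (𝓝 1))
    (horbit : Tendsto (fun r : ℝ => eLpNorm (uncurry (nsRescale r w) - uncurry w) 3
      (volume.restrict (parabolicCylinder 2 (0 : ℝ × EuclideanSpace ℝ (Fin 3))))) (𝓝 1) (𝓝 0))
    (hconv : ∀ R : ℝ, 0 < R → Tendsto (fun j => eLpNorm (uncurry (uj j) - uncurry w) 3
      (volume.restrict (parabolicCylinder R (0 : ℝ × EuclideanSpace ℝ (Fin 3))))) atTop (𝓝 0))
    (hshadow : ∀ j, eLpNorm (fun z : ℝ × EuclideanSpace ℝ (Fin 3) =>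
        rotZ θ (nsRescale (c j) (uj j) z.1 (rotZ (-θ) z.2)) - uj j z.1 z.2) 3
        (volume.restrict (parabolicCylinder 2 (0 : ℝ × EuclideanSpace ℝ (Fin 3)))) ≤ δ' j)
    (hδ' : Tendsto δ' atTop (𝓝 0)) :
    ∀ᵐ z ∂(volume.restrict (parabolicCylinder 2 (0 : ℝ × EuclideanSpace ℝ (Fin 3)))),
      rotZ θ (w z.1 (rotZ (-θ) z.2)) = w z.1 z.2 := by
  have h13 : (1 : ℝ≥0∞) ≤ 3 := by norm_num
  have hwm1 : ∀ R : ℝ, 0 < R → AEStronglyMeasurable (uncurry w)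
      (volume.restrict (parabolicCylinder R (0 : ℝ × EuclideanSpace ℝ (Fin 3)))) := by
    intro R hR
    have h := hwm 1 one_pos R hR
    rwa [nsRescale_one] at h
  have hum1 : ∀ (j : ℕ) (R : ℝ), 0 < R → AEStronglyMeasurable (uncurry (uj j))
      (volume.restrict (parabolicCylinder R (0 : ℝ × EuclideanSpace ℝ (Fin 3)))) := by
    intro j R hR
    have h := hum j 1 one_pos R hR
    rwa [nsRescale_one] at h
  -- measurability of the rotated players on `Q(0,2)`
  have hFm : AEStronglyMeasurable (fun z : ℝ × EuclideanSpace ℝ (Fin 3) => rotZ θ (w z.1 (rotZ (-θ) z.2)))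
      (volume.restrict (parabolicCylinder 2 (0 : ℝ × EuclideanSpace ℝ (Fin 3)))) :=
    rlRotAbs_aesm_conj θ 2 (g := uncurry w) (hwm1 2 two_pos)
  have hGm : ∀ j, AEStronglyMeasurable (fun z : ℝ × EuclideanSpace ℝ (Fin 3) =>
      rotZ θ (nsRescale (c j) (uj j) z.1 (rotZ (-θ) z.2)))
      (volume.restrict (parabolicCylinder 2 (0 : ℝ × EuclideanSpace ℝ (Fin 3)))) := fun j =>
    rlRotAbs_aesm_conj θ 2 (g := uncurry (nsRescale (c j) (uj j))) (hum j _ (hc0 j) 2 two_pos)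
  -- the bound on the scaling constants
  set Kθ : ℝ≥0∞ := ENNReal.ofReal (Real.exp a) *
    (ENNReal.ofReal (Real.exp (-a) ^ 2 * Real.exp (-a) ^ 3)⁻¹) ^ (1 / (3 : ℝ≥0∞).toReal) with hKθ
  have hKθtop : Kθ ≠ ⊤ := ENNReal.mul_ne_top ENNReal.ofReal_ne_top
    (ENNReal.rpow_ne_top_of_nonneg (by norm_num) ENNReal.ofReal_ne_top)
  have hR4 : (0 : ℝ) < Real.exp a * 2 := by positivity
  -- the four-term bound
  have hle : ∀ j, eLpNorm ((fun z : ℝ × EuclideanSpace ℝ (Fin 3) => rotZ θ (w z.1 (rotZ (-θ) z.2))) - uncurry w) 3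
      (volume.restrict (parabolicCylinder 2 (0 : ℝ × EuclideanSpace ℝ (Fin 3)))) ≤
      (eLpNorm (uncurry (nsRescale (c j) w) - uncurry w) 3
          (volume.restrict (parabolicCylinder 2 (0 : ℝ × EuclideanSpace ℝ (Fin 3)))) +
        Kθ * eLpNorm (uncurry (uj j) - uncurry w) 3
          (volume.restrict (parabolicCylinder (Real.exp a * 2) (0 : ℝ × EuclideanSpace ℝ (Fin 3))))) +
      δ' j +
      eLpNorm (uncurry (uj j) - uncurry w) 3
        (volume.restrict (parabolicCylinder 2 (0 : ℝ × EuclideanSpace ℝ (Fin 3)))) := by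
    intro j
    -- `‖R(w∘T) − R((u_j)_{c_j}∘T)‖ = ‖w − (u_j)_{c_j}‖ ≤ ‖w − w_{c_j}‖ + ‖w_{c_j} − (u_j)_{c_j}‖`
    have h1 := rlRotAbs_eLpNorm_conj θ 2 (hwm1 2 two_pos) (hum j _ (hc0 j) 2 two_pos)
    have h2 : eLpNorm (uncurry (nsRescale (c j) w) - uncurry (nsRescale (c j) (uj j))) 3
        (volume.restrict (parabolicCylinder 2 (0 : ℝ × EuclideanSpace ℝ (Fin 3)))) ≤
        Kθ * eLpNorm (uncurry (uj j) - uncurry w) 3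
          (volume.restrict (parabolicCylinder (Real.exp a * 2) (0 : ℝ × EuclideanSpace ℝ (Fin 3)))) := by
      rw [nsRescale_eq_zoom, nsRescale_eq_zoom, eLpNorm_zoom_sub_zoom _ _ (hc0 j) 2, eLpNorm_sub_comm]
      refine mul_le_mul' (rlRotAbs_zoomConst_le (hclo j) (hchi j)) ?_
      exact eLpNorm_mono_measure _ (Measure.restrict_mono
        (SuitableCompactness.parabolicCylinder_zero_mono (mul_nonneg (hc0 j).le zero_le_two)
          (mul_le_mul_of_nonneg_right (hchi j) zero_le_two)) le_rfl)
    have h3 : eLpNorm (uncurry w - uncurry (nsRescale (c j) (uj j))) 3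
        (volume.restrict (parabolicCylinder 2 (0 : ℝ × EuclideanSpace ℝ (Fin 3)))) ≤
        eLpNorm (uncurry (nsRescale (c j) w) - uncurry w) 3
          (volume.restrict (parabolicCylinder 2 (0 : ℝ × EuclideanSpace ℝ (Fin 3)))) +
        Kθ * eLpNorm (uncurry (uj j) - uncurry w) 3
          (volume.restrict (parabolicCylinder (Real.exp a * 2) (0 : ℝ × EuclideanSpace ℝ (Fin 3)))) := by
      have e2 : uncurry w - uncurry (nsRescale (c j) (uj j)) =
          (uncurry w - uncurry (nsRescale (c j) w)) +
            (uncurry (nsRescale (c j) w) - uncurry (nsRescale (c j) (uj j))) := by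
        rw [sub_add_sub_cancel]
      rw [e2]
      calc eLpNorm ((uncurry w - uncurry (nsRescale (c j) w)) +
            (uncurry (nsRescale (c j) w) - uncurry (nsRescale (c j) (uj j)))) 3
            (volume.restrict (parabolicCylinder 2 (0 : ℝ × EuclideanSpace ℝ (Fin 3))))
          ≤ eLpNorm (uncurry w - uncurry (nsRescale (c j) w)) 3
              (volume.restrict (parabolicCylinder 2 (0 : ℝ × EuclideanSpace ℝ (Fin 3)))) +
            eLpNorm (uncurry (nsRescale (c j) w) - uncurry (nsRescale (c j) (uj j))) 3
              (volume.restrict (parabolicCylinder 2 (0 : ℝ × EuclideanSpace ℝ (Fin 3)))) :=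
            eLpNorm_add_le ((hwm1 2 two_pos).sub (hwm _ (hc0 j) 2 two_pos))
              ((hwm _ (hc0 j) 2 two_pos).sub (hum j _ (hc0 j) 2 two_pos)) h13
        _ ≤ _ := by rw [eLpNorm_sub_comm]; exact add_le_add le_rfl h2
    have e : (fun z : ℝ × EuclideanSpace ℝ (Fin 3) => rotZ θ (w z.1 (rotZ (-θ) z.2))) - uncurry w =
        ((fun z : ℝ × EuclideanSpace ℝ (Fin 3) => rotZ θ (w z.1 (rotZ (-θ) z.2))) -
          (fun z : ℝ × EuclideanSpace ℝ (Fin 3) => rotZ θ (nsRescale (c j) (uj j) z.1 (rotZ (-θ) z.2)))) +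
        (((fun z : ℝ × EuclideanSpace ℝ (Fin 3) => rotZ θ (nsRescale (c j) (uj j) z.1 (rotZ (-θ) z.2))) -
            uncurry (uj j)) + (uncurry (uj j) - uncurry w)) := by
      rw [sub_add_sub_cancel, sub_add_sub_cancel]
    have hdiff : (fun z : ℝ × EuclideanSpace ℝ (Fin 3) => rotZ θ (w z.1 (rotZ (-θ) z.2))) -
        (fun z : ℝ × EuclideanSpace ℝ (Fin 3) => rotZ θ (nsRescale (c j) (uj j) z.1 (rotZ (-θ) z.2))) =
        fun z : ℝ × EuclideanSpace ℝ (Fin 3) =>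
          rotZ θ (uncurry w (z.1, rotZ (-θ) z.2)) - rotZ θ (uncurry (nsRescale (c j) (uj j)) (z.1, rotZ (-θ) z.2)) := by
      rfl
    have hshad : eLpNorm ((fun z : ℝ × EuclideanSpace ℝ (Fin 3) =>
        rotZ θ (nsRescale (c j) (uj j) z.1 (rotZ (-θ) z.2))) - uncurry (uj j)) 3
        (volume.restrict (parabolicCylinder 2 (0 : ℝ × EuclideanSpace ℝ (Fin 3)))) ≤ δ' j :=
      hshadow j
    calc eLpNorm ((fun z : ℝ × EuclideanSpace ℝ (Fin 3) => rotZ θ (w z.1 (rotZ (-θ) z.2))) - uncurry w) 3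
          (volume.restrict (parabolicCylinder 2 (0 : ℝ × EuclideanSpace ℝ (Fin 3))))
        ≤ eLpNorm ((fun z : ℝ × EuclideanSpace ℝ (Fin 3) => rotZ θ (w z.1 (rotZ (-θ) z.2))) -
              (fun z : ℝ × EuclideanSpace ℝ (Fin 3) => rotZ θ (nsRescale (c j) (uj j) z.1 (rotZ (-θ) z.2)))) 3
              (volume.restrict (parabolicCylinder 2 (0 : ℝ × EuclideanSpace ℝ (Fin 3)))) +
            eLpNorm ((((fun z : ℝ × EuclideanSpace ℝ (Fin 3) =>
                rotZ θ (nsRescale (c j) (uj j) z.1 (rotZ (-θ) z.2))) - uncurry (uj j)) +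
              (uncurry (uj j) - uncurry w))) 3
              (volume.restrict (parabolicCylinder 2 (0 : ℝ × EuclideanSpace ℝ (Fin 3)))) := by
          rw [e]
          exact eLpNorm_add_le (hFm.sub (hGm j)) (((hGm j).sub (hum1 j 2 two_pos)).add
            ((hum1 j 2 two_pos).sub (hwm1 2 two_pos))) h13
      _ ≤ (eLpNorm (uncurry (nsRescale (c j) w) - uncurry w) 3
              (volume.restrict (parabolicCylinder 2 (0 : ℝ × EuclideanSpace ℝ (Fin 3)))) +
            Kθ * eLpNorm (uncurry (uj j) - uncurry w) 3
              (volume.restrict (parabolicCylinder (Real.exp a * 2) (0 : ℝ × EuclideanSpace ℝ (Fin 3))))) +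
          (δ' j + eLpNorm (uncurry (uj j) - uncurry w) 3
            (volume.restrict (parabolicCylinder 2 (0 : ℝ × EuclideanSpace ℝ (Fin 3))))) := by
          refine add_le_add ?_ ?_
          · rw [hdiff, h1]
            exact h3
          · exact (eLpNorm_add_le ((hGm j).sub (hum1 j 2 two_pos))
              ((hum1 j 2 two_pos).sub (hwm1 2 two_pos)) h13).trans (add_le_add hshad le_rfl)
      _ = _ := by rw [← add_assoc]
  -- the three groups of terms tend to zero
  have hA : Tendsto (fun j => eLpNorm (uncurry (nsRescale (c j) w) - uncurry w) 3
        (volume.restrict (parabolicCylinder 2 (0 : ℝ × EuclideanSpace ℝ (Fin 3)))) +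
      Kθ * eLpNorm (uncurry (uj j) - uncurry w) 3
        (volume.restrict (parabolicCylinder (Real.exp a * 2) (0 : ℝ × EuclideanSpace ℝ (Fin 3)))))
      atTop (𝓝 0) := by
    have h1 : Tendsto (fun j => eLpNorm (uncurry (nsRescale (c j) w) - uncurry w) 3
        (volume.restrict (parabolicCylinder 2 (0 : ℝ × EuclideanSpace ℝ (Fin 3))))) atTop (𝓝 0) :=
      horbit.comp hc1
    have h2 := ENNReal.Tendsto.const_mul (hconv _ hR4) (Or.inr hKθtop) (a := Kθ)
    rw [mul_zero] at h2
    have h := h1.add h2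
    rwa [add_zero] at h
  have hlim := (hA.add hδ').add (hconv 2 two_pos)
  rw [add_zero, add_zero] at hlim
  have h0 := le_antisymm (ge_of_tendsto' hlim hle) (zero_le (a := eLpNorm
    ((fun z : ℝ × EuclideanSpace ℝ (Fin 3) => rotZ θ (w z.1 (rotZ (-θ) z.2))) - uncurry w) 3
    (volume.restrict (parabolicCylinder 2 (0 : ℝ × EuclideanSpace ℝ (Fin 3))))))
  rw [eLpNorm_eq_zero_iff (hFm.sub (hwm1 2 two_pos)) (by norm_num)] at h0
  filter_upwards [h0] with z hz
  rw [Pi.sub_apply, Pi.zero_apply, sub_eq_zero] at hz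
  exact hz

/-- **Branch C, fast branch — rotational absorption.**  For every rate constant `C` and bound
`M < ⊤` there are `ᾱ` and `δ > 0` such that a suitable weak solution `(u, p)` of Navier–Stokes
(`ν = 1`, `f = 0`) on `ℝ³ × ℝ₋` with weak gradient `G`, `𝐈(ℝ³ × ℝ₋) ≤ M` and the Type-I rate
`‖u(t,x)‖ ≤ C/√(−t)`, whose scaling orbit is `δ`-SHADOWED on `Q(0,2)` by a one-parameter rotation
about the `x₃`-axis of angular log-speed `α` with `|α| ≥ ᾱ` — `‖R_{ασ} u_{e^σ} ∘ T_{−ασ} − u‖_{L³(Q(0,2))} ≤ δ`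
for every log-scale `σ` — is regular at the space–time origin (exact shadowing, `δ = 0`, is the
rotated-self-similar ansatz; first lemma (iii) of the card `rung-neighbourhoods`).  Proof: if
`ᾱ_k = k + 1`, `δ_k = 1/(k+1)` fail with `α_k`, `u_k`, a subsequence of the `u_k` converges in every
`L³(Q(0,R))` to an origin-singular class profile `w` with the rate (`stub_rlClassLimit`); for a fixed
angle `θ` the log-scales `σ_j = θ/α_j → 0` reach `θ` exactly, and the continuity of the scaling
orbit of `w` (`stub_rlOrbitContinuous`) turns the shadowing into `R_θ (w ∘ T_{−θ}) = w` a.e. on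
`Q(0,2)` (`rlRotAbs_fixedAngle`), i.e. `w` is a.e. axisymmetric there; an a.e.-axisymmetric class
profile is regular (`stub_rlAxisymRegular`, the local Seregin–Šverák theorem) — contradiction.
[cite: SereginSverak2009, Thm. 3.1 (= Thm. 1.1); AlbrittonBarker2019, Lemma 2.2, Prop. 2.3] -/
theorem rotationalAbsorptionFast :
    ∀ (C : ℝ) (M : ℝ≥0∞), M < ⊤ → ∃ αbar δ : ℝ, 0 < δ ∧
      ∀ (α : ℝ), αbar ≤ |α| →
        ∀ (u : ℝ → EuclideanSpace ℝ (Fin 3) → EuclideanSpace ℝ (Fin 3))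
          (p : ℝ → EuclideanSpace ℝ (Fin 3) → ℝ)
          (G : ℝ → EuclideanSpace ℝ (Fin 3) → EuclideanSpace ℝ (Fin 3) →L[ℝ] EuclideanSpace ℝ (Fin 3)),
          IsSuitableWeakSolutionOn (slab (EuclideanSpace ℝ (Fin 3)) (Iio 0) isOpen_Iio) 1 0 u p →
          HasWeakSpatialGradientOn (slab (EuclideanSpace ℝ (Fin 3)) (Iio 0) isOpen_Iio) u G →
          typeIBound (Iio (0 : ℝ) ×ˢ univ) u p G ≤ M →
          HasTypeITimeDecay C u →
          (∀ σ : ℝ, eLpNorm (fun z : ℝ × EuclideanSpace ℝ (Fin 3) =>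
              rotZ (α * σ) (nsRescale (Real.exp σ) u z.1 (rotZ (-(α * σ)) z.2)) - u z.1 z.2) 3
              (volume.restrict (parabolicCylinder 2 (0 : ℝ × EuclideanSpace ℝ (Fin 3)))) ≤
            ENNReal.ofReal δ) →
          ¬ IsBackwardSingularPoint u 0 := by
  intro C M hM
  by_contra hcon
  push Not at hcon
  have hδk : ∀ k : ℕ, (0 : ℝ) < 1 / ((k : ℝ) + 1) := fun k => by positivity
  choose α hα u p G hsw hwg hI hdec hshadow hsing using fun k : ℕ => hcon ((k : ℝ) + 1) _ (hδk k)
  -- S1: a singular class limit with the rate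
  obtain ⟨w, q, H, ψ, hψ, hsw', hwg', hI', hdec', hsing', hconv⟩ :=
    stub_rlClassLimit C M hM u p G hsw hwg hI hdec hsing
  -- measurability of (rescaled) class profiles on the balls
  have hmeas : ∀ (k : ℕ) (c : ℝ), 0 < c → ∀ R : ℝ, 0 < R →
      AEStronglyMeasurable (uncurry (nsRescale c (u k)))
        (volume.restrict (parabolicCylinder R (0 : ℝ × EuclideanSpace ℝ (Fin 3)))) := by
    intro k c hc R _
    rw [nsRescale_eq_zoom]
    exact (zoom_slabProfile (hsw k) (hwg k) hc).2.1.locallyIntegrableOn.aestronglyMeasurable.mono_measure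
      (Measure.restrict_mono (parabolicCylinder_origin_subset_slab _) le_rfl)
  have hmeasw : ∀ (c : ℝ), 0 < c → ∀ R : ℝ, 0 < R →
      AEStronglyMeasurable (uncurry (nsRescale c w))
        (volume.restrict (parabolicCylinder R (0 : ℝ × EuclideanSpace ℝ (Fin 3)))) := by
    intro c hc R _
    rw [nsRescale_eq_zoom]
    exact (zoom_slabProfile hsw' hwg' hc).2.1.locallyIntegrableOn.aestronglyMeasurable.mono_measure
      (Measure.restrict_mono (parabolicCylinder_origin_subset_slab _) le_rfl)
  -- S6: the orbit of `w` is continuous in `L³` on the balls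
  have horbit := stub_rlOrbitContinuous w (fun R hR => memLp_three_of_slabProfile hwg' hI' hR)
  have hα0 : ∀ j, α (ψ j) ≠ 0 := fun j => by
    have h := hα (ψ j)
    intro h0
    rw [h0, abs_zero] at h
    linarith [(Nat.cast_nonneg (ψ j) : (0 : ℝ) ≤ ψ j)]
  -- KEY: `w` is a.e. axisymmetric on `Q(0,2)`
  have hconjfix : ∀ θ : ℝ, ∀ᵐ z ∂(volume.restrict (parabolicCylinder 2 (0 : ℝ × EuclideanSpace ℝ (Fin 3)))),
      rotZ θ (w z.1 (rotZ (-θ) z.2)) = w z.1 z.2 := by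
    intro θ
    -- the log-scales `σ_j = θ / α_j → 0` and the scales `c_j = e^{σ_j} → 1`
    obtain ⟨σ, hσ⟩ : ∃ σ : ℕ → ℝ, ∀ j, σ j = θ / α (ψ j) := ⟨fun j => θ / α (ψ j), fun j => rfl⟩
    have hσθ : ∀ j, α (ψ j) * σ j = θ := fun j => by
      rw [hσ j, mul_div_cancel₀ θ (hα0 j)]
    have hσb : ∀ j, |σ j| ≤ |θ| := fun j => by
      rw [hσ j, abs_div]
      have h1 : (1 : ℝ) ≤ |α (ψ j)| :=
        le_trans (by linarith [(Nat.cast_nonneg (ψ j) : (0 : ℝ) ≤ ψ j)]) (hα (ψ j))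
      exact div_le_self (abs_nonneg θ) h1
    have hσ0 : Tendsto σ atTop (𝓝 0) := by
      have hb : ∀ j, |σ j| ≤ |θ| / (((ψ j : ℕ) : ℝ) + 1) := fun j => by
        rw [hσ j, abs_div]
        exact div_le_div_of_nonneg_left (abs_nonneg θ) (by positivity) (hα (ψ j))
      have h0 : Tendsto (fun j => |θ| / (((ψ j : ℕ) : ℝ) + 1)) atTop (𝓝 0) := by
        have h := ((tendsto_one_div_add_atTop_nhds_zero_nat (𝕜 := ℝ)).comp hψ.tendsto_atTop).const_mul |θ|
        rw [mul_zero] at h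
        refine h.congr fun j => ?_
        simp only [Function.comp_apply]
        ring
      exact squeeze_zero_norm hb h0
    obtain ⟨c, hc⟩ : ∃ c : ℕ → ℝ, ∀ j, c j = Real.exp (σ j) := ⟨fun j => Real.exp (σ j), fun j => rfl⟩
    have hc0 : ∀ j, 0 < c j := fun j => by rw [hc j]; exact Real.exp_pos _
    have hc1 : Tendsto c atTop (𝓝 1) := by
      have h := (Real.continuous_exp.tendsto 0).comp hσ0
      rw [Real.exp_zero] at h
      exact h.congr fun j => (hc j).symm
    have hclo : ∀ j, Real.exp (-|θ|) ≤ c j := fun j => by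
      rw [hc j]
      exact Real.exp_le_exp.2 (by have := hσb j; have := neg_abs_le (σ j); linarith)
    have hchi : ∀ j, c j ≤ Real.exp |θ| := fun j => by
      rw [hc j]
      exact Real.exp_le_exp.2 ((le_abs_self _).trans (hσb j))
    -- the shadowing at `σ_j`, rewritten with `c_j`
    have hshadowj : ∀ j, eLpNorm (fun z : ℝ × EuclideanSpace ℝ (Fin 3) =>
        rotZ θ (nsRescale (c j) (u (ψ j)) z.1 (rotZ (-θ) z.2)) - u (ψ j) z.1 z.2) 3
        (volume.restrict (parabolicCylinder 2 (0 : ℝ × EuclideanSpace ℝ (Fin 3)))) ≤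
        ENNReal.ofReal (1 / (((ψ j : ℕ) : ℝ) + 1)) := by
      intro j
      have h := hshadow (ψ j) (σ j)
      rw [hσθ j, ← hc j] at h
      exact h
    have hδ' : Tendsto (fun j => ENNReal.ofReal (1 / (((ψ j : ℕ) : ℝ) + 1))) atTop (𝓝 0) := by
      have h := ENNReal.tendsto_ofReal
        ((tendsto_one_div_add_atTop_nhds_zero_nat (𝕜 := ℝ)).comp hψ.tendsto_atTop)
      rw [ENNReal.ofReal_zero] at h
      simpa only [Function.comp_def] using h
    exact rlRotAbs_fixedAngle θ |θ| (uj := fun j => u (ψ j)) (fun j => hmeas (ψ j)) hmeasw hc0 hclo hchi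
      hc1 (horbit 2 two_pos) hconv hshadowj hδ'
  have hax : ∀ θ : ℝ, ∀ᵐ z ∂(volume.restrict (parabolicCylinder 2 (0 : ℝ × EuclideanSpace ℝ (Fin 3)))),
      w z.1 (rotZ θ z.2) = rotZ θ (w z.1 z.2) := by
    intro θ
    have h := (Seregin2020.measurePreserving_rotST_restrict θ 2).quasiMeasurePreserving.ae (hconjfix θ)
    filter_upwards [h] with z hz
    rw [← rotZ_add, neg_add_cancel, rotZ_zero] at hz
    exact hz.symm
  -- C1: an a.e.-axisymmetric class profile is regular — contradiction
  exact stub_rlAxisymRegular C w q H hsw' hwg' hI' hdec' hax hsing'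

/-- **Registered alias** (stub `stub_rlRotationalAbsorptionFast` of crux stmt-NavierStokesRegularity-1589,
line Sketch), verbatim `rotationalAbsorptionFast`. [cite: SereginSverak2009, Thm. 3.1 (= Thm. 1.1)] -/
theorem stub_rlRotationalAbsorptionFast :
    ∀ (C : ℝ) (M : ℝ≥0∞), M < ⊤ → ∃ αbar δ : ℝ, 0 < δ ∧
      ∀ (α : ℝ), αbar ≤ |α| →
        ∀ (u : ℝ → EuclideanSpace ℝ (Fin 3) → EuclideanSpace ℝ (Fin 3))
          (p : ℝ → EuclideanSpace ℝ (Fin 3) → ℝ)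
          (G : ℝ → EuclideanSpace ℝ (Fin 3) → EuclideanSpace ℝ (Fin 3) →L[ℝ] EuclideanSpace ℝ (Fin 3)),
          IsSuitableWeakSolutionOn (slab (EuclideanSpace ℝ (Fin 3)) (Iio 0) isOpen_Iio) 1 0 u p →
          HasWeakSpatialGradientOn (slab (EuclideanSpace ℝ (Fin 3)) (Iio 0) isOpen_Iio) u G →
          typeIBound (Iio (0 : ℝ) ×ˢ univ) u p G ≤ M →
          HasTypeITimeDecay C u →
          (∀ σ : ℝ, eLpNorm (fun z : ℝ × EuclideanSpace ℝ (Fin 3) =>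
              rotZ (α * σ) (nsRescale (Real.exp σ) u z.1 (rotZ (-(α * σ)) z.2)) - u z.1 z.2) 3
              (volume.restrict (parabolicCylinder 2 (0 : ℝ × EuclideanSpace ℝ (Fin 3)))) ≤
            ENNReal.ofReal δ) →
          ¬ IsBackwardSingularPoint u 0 :=
  fun C M hM => rotationalAbsorptionFast C M hM

end Summit.NavierStokesRegularity.NavierStokesRegularity.Theorems

end
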